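/-
Copyright: pub-hodgecm formalisation cell (harness21, 2026). New file (not vendored).
-/
import Summits.HodgeConjecture.HodgeCM.StubTree.PerLProof
import Summits.HodgeConjecture.HodgeCM.StubTree.Reduction

/-!
# Assembly: PerL, the period theorem over F, W^{RK4} and COR-CM (pure-logic wiring, fully proved)

The implications of the dependency table of the follow-ups doc §B.1, PROVED as pure logic over the exact
statements (`HodgeCM.Geometry.Statements`), and the end-to-end theorems, whose hypotheses are the model facts
`M : U.ModelAxioms` (28 cited standard facts, `HodgeCM.Geometry.Facts`) and — since gen 6, when the package
dropped its last placeholder stubs — exactly the OPEN INPUTS each needs (`HodgeCM.StubTree.Inputs`):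
`COR_CM : ModelAxioms → RealisationExistsFace → PohlmannSpan → Qw8Sufficiency → HC_CM`,
`perL : ModelAxioms → RealisationExistsPerL → PerL`.  `#print axioms` of every theorem of this file is
`[propext, Classical.choice, Quot.sound]` (AXIOMS.md).

```
PerL44 ──► PerL                         (perL_of_perL44; Landherr)
PeriodThmF + SurfaceCriterion ──► W_RK4 (w_rk4_of; Landherr, dim P_Γ = 2, rfwf Lemma 2.1)
W_RK4 + FaceReduction + Lemma81 ──► HC_CM = COR-CM   (hc_cm_of)
```
-/

noncomputable section

namespace HodgeCM

namespace Assembly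

open Universe StubTree

variable (U : Universe)

/-- `W_per^L` from Thm 4.4: pick any hermitian space (Landherr). -/
theorem perL_of_perL44 (hL : LandherrExists) (h44 : U.PerL44) : U.PerL := by
  intro K L j hN hK hdeg φ hφ ι₁ hι t ht
  obtain ⟨V⟩ := hL L ι₁
  exact ⟨V, h44 K L j hN hK hdeg φ hφ ι₁ hι t ht V⟩

/-- **rfwf Thm 1.3 from Thm 4.1 + Prop 2.2** ("By Theorem 4.1 the hypothesis of Proposition 2.2 holds (with
`S = P_Γ`); Proposition 2.2 gives the conclusion"). -/
theorem w_rk4_of (h41 : U.PeriodThmF) (h22 : U.SurfaceCriterion) (hL : LandherrExists)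
    (hdim : U.PmsDimTwo) (hadm : AdmissibleExists) : U.W_RK4 := by
  intro F hG h6 f
  obtain ⟨ι₁, hι⟩ := hadm F h6 f
  obtain ⟨V⟩ := hL F ι₁
  obtain ⟨Γ, Fm, α, hα, hper⟩ := h41 F hG h6 f ι₁ hι V
  exact h22 F hG f ι₁ hι (U.pms F ι₁ V Γ) (hdim F ι₁ V Γ) Fm α hα hper

/-- **COR-CM from `W^{RK4}` and the two reductions** (rows (ii)–(v) of the table). -/
theorem hc_cm_of (h1 : U.W_RK4) (h2 : U.FaceReduction) (h3 : U.Lemma81) : U.HC_CM :=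
  h3 (fun F hG h6 n Θ => h2 F hG h6 (h1 F hG h6) n Θ)

/-! ### End-to-end, from the model facts and the named open inputs -/

/-- **PerL** (`W_per^L`), end-to-end: model facts + the open input `RealisationExistsPerL` (PerL §§3–4)
give `W_per^L` (Landherr's existence theorem is PROVED: `landherr_exists`). -/
theorem perL (M : U.ModelAxioms) (hR : U.RealisationExistsPerL) : U.PerL :=
  perL_of_perL44 U landherr_exists (perL44_holds U M hR)

/-- **rfwf Thm 4.1**, end-to-end: model facts + the open input `RealisationExistsFace` (rfwf §4.2). -/
theorem periodThmF (M : U.ModelAxioms) (hR : U.RealisationExistsFace) : U.PeriodThmF :=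
  periodThmF_holds U M hR

/-- **`W^{RK4}`** (rfwf Thm 1.3), end-to-end: model facts + `RealisationExistsFace`; the surface criterion
(rfwf Prop 2.2), Landherr existence, `dim P_Γ = 2` and rfwf Lemma 2.1 are PROVED / model facts. -/
theorem w_rk4 (M : U.ModelAxioms) (hR : U.RealisationExistsFace) : U.W_RK4 :=
  w_rk4_of U (periodThmF U M hR) (prop22_surfaceCriterion U M) landherr_exists M.pms_dim admissible_exists

/-- **COR-CM**: the Hodge conjecture for all CM abelian varieties of the universe `U`, from the 28 model facts
and exactly three named open inputs — the transposed theta realisation (rfwf §4.2 / PerL §§3–4), Pohlmann 1968,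
and [QW8] Thm 2.5 + Milne 1999 (see `HOME/lean/SKELETON.md` §4 and AXIOMS.md; closure
`[propext, Classical.choice, Quot.sound]`). -/
theorem COR_CM (M : U.ModelAxioms) (hR : U.RealisationExistsFace) (hP : U.PohlmannSpan)
    (hQ : U.Qw8Sufficiency) : U.HC_CM :=
  hc_cm_of U (w_rk4 U M hR) (faceReduction_holds U hP hQ) (lemma81_holds U M)

/-- **COR-CM from the record of open inputs** (`HodgeCM.Universe.OpenInputs`). -/
theorem COR_CM_of_openInputs (M : U.ModelAxioms) (I : U.OpenInputs) : U.HC_CM :=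
  COR_CM U M I.realisation_face I.pohlmann_span I.qw8_sufficiency

/-- **PerL from the record of open inputs**. -/
theorem perL_of_openInputs (M : U.ModelAxioms) (I : U.OpenInputs) : U.PerL :=
  perL U M I.realisation_perL

end Assembly

end HodgeCM

end
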